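import Literature.AlgebraicGeometry.Resolution.QuadraticTransformsRegular
import Summits.ResolutionOfSingularities.ResolutionOfSingularities.Theorems.ValuativeLuAlphaPTorsorContentSandwich
import Summits.ResolutionOfSingularities.ResolutionOfSingularities.Theorems.ValuativeLuAlphaPTorsorPrimeDichotomy
import Summits.ResolutionOfSingularities.ResolutionOfSingularities.Theorems.ValuativeLuAlphaPTorsorCornerStep

/-!
# The support of the content ideal of `df` along the quadratic sequence

Helper file for the stub `content_support_along_sequence` (PH1-a) of the line
`pfaff-line-log-final-forms` (crux `Valuative.LuAlphaPTorsor`, item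
`stmt-ResolutionOfSingularities-0641`).

Setting: `K` a field, `O ⊆ K` a valuation ring, `R 0 → R 1 → ⋯` the sequence of quadratic
transforms along `O` of a two-dimensional regular local ring `R 0 ⊆ K` dominated by `O`, every
member rich in `ℤ`-derivations. For `f ∈ R 0` write `f_i ∈ R i` for its image and
`J_i := Ideal.span {δ f_i | δ ∈ Der_ℤ(R i)}` for the (full) content ideal of `df_i`. If
`J_0 = (g₀) · J₀` with `J₀` of finite colength, `g₀ ≠ 0`, and `x₀ ∈ 𝔪_0`, then for every `i`
(all of `R 0, …, R i` two-dimensional) every prime `𝔭 ≠ 𝔪_i` of `R i` containing `J_i` contains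
`(x₀ g₀)_i`.

Proof: induction on `i`, carrying also `J_i ≠ 0`.
* `i = 0`: `(g₀) J₀ ⊆ 𝔭` and `J₀ ⊄ 𝔭` (`𝔪^n ⊆ J₀` would force `𝔭 = 𝔪`), so `g₀ ∈ 𝔭`.
* `i → i + 1`: with `x ∈ 𝔪_i` the exceptional parameter, the sandwich
  `(x) J_i R_{i+1} ⊆ J_{i+1} ⊆ J_i R_{i+1}` (`content_empty_quadraticTransform_sandwich`) gives
  `J_{i+1} ≠ 0`, and for a prime `𝔭 ≠ 𝔪_{i+1}` containing `J_{i+1}` either `x ∈ 𝔭`, whence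
  `𝔭 ∩ R i = 𝔪_i ∋ (x₀ g₀)_i` (`prime_quadraticTransform_dichotomy` (i)), or `J_i ⊆ 𝔭 ∩ R i`,
  a prime different from `𝔪_i` (`prime_quadraticTransform_dichotomy` (ii)), and the induction
  hypothesis applies. [folklore]
-/

set_option linter.dupNamespace false

noncomputable section

open IsLocalRing Literature.AlgebraicGeometry.Resolution

namespace Summit.ResolutionOfSingularities.ResolutionOfSingularities.Theorems.PfaffLine

section ContentSupport

variable {K : Type} [Field K]

/-- The content ideal with EMPTY boundary condition is the full content ideal
`Ideal.span {δ f | δ ∈ Der_ℤ(R)}` (the boundary condition `∀ i ∈ ∅, …` is vacuous). [folklore] -/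
theorem span_content_empty_eq_contentSupport {R : Type*} [CommRing R] {d : ℕ} (u : Fin d → R)
    (f : R) :
    Ideal.span {b | ∃ δ : Derivation ℤ R R,
        (∀ i ∈ (∅ : Finset (Fin d)), δ (u i) ∈ Ideal.span {u i}) ∧ δ f = b} =
      Ideal.span {b | ∃ δ : Derivation ℤ R R, δ f = b} := by
  congr 1
  ext b
  exact exists_congr fun δ => and_iff_right fun i hi => absurd hi (Finset.notMem_empty i)

/-- **In a local ring, a prime containing an ideal of finite colength is the maximal ideal**:
`𝔪ⁿ ⊆ J ⊆ 𝔭` for some `n` (`R/J` is Artinian), hence `𝔪 ⊆ 𝔭`. [folklore] -/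
theorem eq_maximalIdeal_of_le_of_isFiniteLength_contentSupport {R : Type*} [CommRing R]
    [IsLocalRing R] {J 𝔭 : Ideal R} [𝔭.IsPrime] (hfin : IsFiniteLength R (R ⧸ J))
    (hle : J ≤ 𝔭) : 𝔭 = maximalIdeal R := by
  obtain ⟨-, hArt⟩ := isFiniteLength_iff_isNoetherian_isArtinian.mp hfin
  haveI : IsArtinianRing (R ⧸ J) := isArtinian_of_tower R hArt
  obtain ⟨n, hn⟩ := exists_maximalIdeal_pow_le_of_isArtinianRing_quotient J
  exact ((maximalIdeal.isMaximal R).eq_of_le (Ideal.IsPrime.ne_top ‹_›)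
    (Ideal.IsPrime.le_of_pow_le (hn.trans hle))).symm

/-- **Non-units of `R 0` stay non-units along a dominating extension**: if `S` dominates `R`
(`SubringDominates R S`) and `a ∈ R` is not a unit of `R`, then `a` is not a unit of `S`.
[folklore] -/
theorem not_isUnit_inclusion_of_subringDominates_contentSupport {R S : Subring K}
    (h : SubringDominates R S) {a : R} (ha : ¬ IsUnit a) :
    ¬ IsUnit (Subring.inclusion h.1 a) := by
  intro hu
  apply ha
  rw [isUnit_subring_iff_inv_mem] at hu ⊢
  exact ⟨hu.1, h.2 _ a.2 hu.2⟩

/-- **One step of the support transfer.** Let `R ⊆ K` be a two-dimensional regular local ring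
dominated by `O` and rich in `ℤ`-derivations, `R₁` its quadratic transform along `O`,
`φ : R → R₁` the inclusion, `f ∈ R`, `c ∈ 𝔪_R`, and `J(f) := Ideal.span {δ f | δ ∈ Der_ℤ(R)}`.
If `J(f) ≠ 0` and every prime `𝔭 ≠ 𝔪_R` containing `J(f)` contains `c`, then `J(φ f) ≠ 0` and
every prime `𝔭₁ ≠ 𝔪_{R₁}` of `R₁` containing `J(φ f)` contains `φ c`: by the sandwich
`(φ x) J(f) R₁ ⊆ J(φ f) ⊆ J(f) R₁` (`x` the exceptional parameter), either `φ x ∈ 𝔭₁` and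
`𝔭₁ ∩ R = 𝔪_R ∋ c`, or `J(f) ⊆ 𝔭₁ ∩ R ≠ 𝔪_R` (`prime_quadraticTransform_dichotomy`).
[folklore] -/
theorem content_support_step_contentSupport (O : ValuationSubring K) (R R₁ : Subring K)
    [IsRegularLocalRing R] [IsLocalRing R₁] (h : IsQuadraticTransformAlong O R R₁)
    (hdim : ringKrullDim R = 2) (hdom : SubringDominates R O.toSubring)
    (hrich : ∀ (N : Type) [CommRing N] (ψ : R →+* N) (δ₀ : R →+ N),
      (∀ a b, δ₀ (a * b) = ψ a * δ₀ b + ψ b * δ₀ a) → ∀ Y : Finset R,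
        ∃ (m : ℕ) (Δ : Fin m → Derivation ℤ R R) (nn : Fin m → N),
          ∀ y ∈ Y, δ₀ y = Finset.univ.sum fun j => ψ (Δ j y) * nn j)
    (f c : R) (hc : c ∈ maximalIdeal R)
    (hJ0 : Ideal.span {b | ∃ δ : Derivation ℤ R R, δ f = b} ≠ ⊥)
    (hJ : ∀ 𝔭 : Ideal R, 𝔭.IsPrime → 𝔭 ≠ maximalIdeal R →
      Ideal.span {b | ∃ δ : Derivation ℤ R R, δ f = b} ≤ 𝔭 → c ∈ 𝔭) :
    Ideal.span {b | ∃ δ : Derivation ℤ R₁ R₁, δ (Subring.inclusion h.le f) = b} ≠ ⊥ ∧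
      ∀ 𝔭 : Ideal R₁, 𝔭.IsPrime → 𝔭 ≠ maximalIdeal R₁ →
        Ideal.span {b | ∃ δ : Derivation ℤ R₁ R₁, δ (Subring.inclusion h.le f) = b} ≤ 𝔭 →
          Subring.inclusion h.le c ∈ 𝔭 := by
  -- the exceptional parameter `x ∈ 𝔪_R` of minimal value
  obtain ⟨_, x, hxm, hx0, hmin, -⟩ := h.exists_eq_locAtCentre
  have hinj : Function.Injective (Subring.inclusion h.le) := Subring.inclusion_injective h.le
  -- the sandwich `(φ x) J(f) R₁ ⊆ J(φ f) ⊆ J(f) R₁` (empty boundaries, `d = d' = 0`)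
  obtain ⟨u⟩ : Nonempty (Fin 0 → R) := ⟨fun i => i.elim0⟩
  obtain ⟨u'⟩ : Nonempty (Fin 0 → R₁) := ⟨fun i => i.elim0⟩
  have hT6 := content_empty_quadraticTransform_sandwich O R R₁ h hrich u (fun i => i.elim0)
    (fun i => i.elim0) u' x hxm f
  rw [span_content_empty_eq_contentSupport u f,
    span_content_empty_eq_contentSupport u' (Subring.inclusion h.le f)] at hT6
  obtain ⟨hlow, -⟩ := hT6
  -- `J(φ f) ≠ 0`
  have hmapne : (Ideal.span {b | ∃ δ : Derivation ℤ R R, δ f = b}).map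
      (Subring.inclusion h.le) ≠ ⊥ := by
    rw [Ne, Ideal.map_eq_bot_iff_of_injective hinj]
    exact hJ0
  have hxne : Ideal.span {Subring.inclusion h.le x} ≠ ⊥ := by
    rw [Ne, Ideal.span_singleton_eq_bot]
    exact fun e => hx0 (hinj (by rw [e, map_zero]))
  have hJ1ne : Ideal.span {b | ∃ δ : Derivation ℤ R₁ R₁, δ (Subring.inclusion h.le f) = b} ≠ ⊥ := by
    intro hbot
    rw [hbot, le_bot_iff, Ideal.mul_eq_bot] at hlow
    exact hlow.elim hxne hmapne
  refine ⟨hJ1ne, fun 𝔭 h𝔭 h𝔭m hJ𝔭 => ?_⟩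
  haveI := h𝔭
  have hP := prime_quadraticTransform_dichotomy O R R₁ h hdim hdom x hxm hmin 𝔭 h𝔭 h𝔭m
  by_cases hx𝔭 : Subring.inclusion h.le x ∈ 𝔭
  · -- the exceptional curve: `𝔭 ∩ R = 𝔪_R ∋ c`
    have hc' : c ∈ 𝔭.comap (Subring.inclusion h.le) := by
      rw [(hP.1 hx𝔭).2]
      exact hc
    exact Ideal.mem_comap.mp hc'
  · -- a strict transform: `J(f) ⊆ 𝔭 ∩ R`, a prime `≠ 𝔪_R`
    have h𝔭0 : 𝔭 ≠ ⊥ := fun e => hJ1ne (le_bot_iff.mp (e ▸ hJ𝔭))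
    have hcm : 𝔭.comap (Subring.inclusion h.le) ≠ maximalIdeal R := (hP.2 hx𝔭 h𝔭0).1
    have hle : Ideal.span {b | ∃ δ : Derivation ℤ R R, δ f = b} ≤
        𝔭.comap (Subring.inclusion h.le) := by
      rw [← Ideal.map_le_iff_le_comap]
      refine ((Ideal.IsPrime.mul_le h𝔭).mp (hlow.trans hJ𝔭)).resolve_left fun hx => hx𝔭 ?_
      exact hx (Ideal.mem_span_singleton_self _)
    exact Ideal.mem_comap.mp (hJ _ (Ideal.comap_isPrime _ 𝔭) hcm hle)

end ContentSupport

/-- **Registered stub `content_support_along_sequence`** (PH1-a: the support of the content ideal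
along the quadratic sequence). Along the sequence `R 0 → R 1 → ⋯` of quadratic transforms along
`O` of a two-dimensional regular local ring `R 0 ⊆ K` dominated by `O` (all members rich in
`ℤ`-derivations), let `f ∈ R 0` with `Ideal.span {δ f | δ} = (g₀) · J₀`, `J₀` of finite
colength, `g₀ ≠ 0`, and `x₀` a non-unit of `R 0`. Then for every `i` with `R 0, …, R i`
two-dimensional, every non-maximal prime `𝔭` of `R i` containing the full content ideal
`Ideal.span {δ f_i | δ ∈ Der_ℤ(R i)}` of the image `f_i` of `f` contains the image of `x₀ g₀`.
Proof: induction on `i` carrying `J_i ≠ 0`; the base case is `J₀ ⊄ 𝔭` (finite colength), the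
step is `content_support_step_contentSupport` (sandwich of the content along one quadratic
transform plus the dichotomy of primes of the transform). [folklore] -/
theorem content_support_along_sequence : ∀ {K : Type} [Field K] (O : ValuationSubring K) (R : ℕ → Subring K), IsRegularLocalRing (R 0) → ringKrullDim (R 0) = 2 → Literature.AlgebraicGeometry.Resolution.SubringDominates (R 0) O.toSubring → ∀ (hstep : ∀ i, Literature.AlgebraicGeometry.Resolution.IsQuadraticTransformAlong O (R i) (R (i + 1))), (∀ (i : ℕ) (N : Type) [CommRing N] (ψ : R i →+* N) (δ₀ : R i →+ N), (∀ a b, δ₀ (a * b) = ψ a * δ₀ b + ψ b * δ₀ a) → ∀ Y : Finset (R i), ∃ (m : ℕ) (Δ : Fin m → Derivation ℤ (R i) (R i)) (nn : Fin m → N), ∀ y ∈ Y, δ₀ y = Finset.univ.sum fun j => ψ (Δ j y) * nn j) → (∀ (i : ℕ) (v : Fin 2 → R i), (∀ z : R i, z ∈ Ideal.span (Set.range v) ↔ ¬ IsUnit z) → ∃ D : Fin 2 → Derivation ℤ (R i) (R i), ∀ l j, D l (v j) = if l = j then 1 else 0) → ∀ (f g₀ x₀ : R 0) (J₀ : Ideal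 (R 0)), Ideal.span {b | ∃ δ : Derivation ℤ (R 0) (R 0), δ f = b} = Ideal.span {g₀} * J₀ → IsFiniteLength (R 0) (R 0 ⧸ J₀) → g₀ ≠ 0 → ¬ IsUnit x₀ → (∀ z : R 0, ¬ IsUnit z → O.valuation (z : K) ≤ O.valuation ((x₀ : R 0) : K)) → ∀ (i : ℕ), (∀ j, j ≤ i → ringKrullDim (R j) = 2) → ∀ (𝔭 : Ideal (R i)), 𝔭.IsPrime → (∃ z : R i, ¬ IsUnit z ∧ z ∉ 𝔭) → Ideal.span {b | ∃ δ : Derivation ℤ (R i) (R i), δ (Subring.inclusion (Literature.AlgebraicGeometry.Resolution.sequence_monotone hstep (Nat.zero_le i)) f) = b} ≤ 𝔭 → Subring.inclusion (Literature.AlgebraicGeometry.Resolution.sequence_monotone hstep (Nat.zero_le i)) (x₀ * g₀) ∈ 𝔭 := by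
  intro K _ O R hreg hdim0 h0 hstep hrich _ f g₀ x₀ J₀ hJ hfin hg0 hx₀ _
  haveI hregi : ∀ i, IsRegularLocalRing (R i) := isRegularLocalRing_sequence hreg hstep
  -- `(x₀ g₀)_i ∈ 𝔪_i`: non-units of `R 0` stay non-units in `R i` (domination)
  have hcm : ∀ i, Subring.inclusion (sequence_monotone hstep (Nat.zero_le i)) (x₀ * g₀) ∈
      maximalIdeal (R i) := fun i => by
    rw [map_mul]
    exact Ideal.mul_mem_right _ _
      (not_isUnit_inclusion_of_subringDominates_contentSupport (sequence_dominates h0 hstep i).2 hx₀)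
  -- induction on `i`, carrying `J_i ≠ 0`
  have key : ∀ i : ℕ, (∀ j, j ≤ i → ringKrullDim (R j) = 2) →
      Ideal.span {b | ∃ δ : Derivation ℤ (R i) (R i),
          δ (Subring.inclusion (sequence_monotone hstep (Nat.zero_le i)) f) = b} ≠ ⊥ ∧
        ∀ 𝔭 : Ideal (R i), 𝔭.IsPrime → 𝔭 ≠ maximalIdeal (R i) →
          Ideal.span {b | ∃ δ : Derivation ℤ (R i) (R i),
              δ (Subring.inclusion (sequence_monotone hstep (Nat.zero_le i)) f) = b} ≤ 𝔭 →
            Subring.inclusion (sequence_monotone hstep (Nat.zero_le i)) (x₀ * g₀) ∈ 𝔭 := by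
    intro i
    induction i with
    | zero =>
      intro _
      have hf0 : Subring.inclusion (sequence_monotone hstep (Nat.zero_le 0)) f = f :=
        Subtype.ext rfl
      have hc0 : Subring.inclusion (sequence_monotone hstep (Nat.zero_le 0)) (x₀ * g₀) = x₀ * g₀ :=
        Subtype.ext rfl
      rw [hf0, hc0, hJ]
      have hJ₀ne : J₀ ≠ ⊥ := ne_bot_of_isFiniteLength_quotient_cornerStep hdim0 hfin
      refine ⟨?_, fun 𝔭 h𝔭 h𝔭m hle => ?_⟩
      · rw [Ne, Ideal.mul_eq_bot, not_or, Ideal.span_singleton_eq_bot]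
        exact ⟨hg0, hJ₀ne⟩
      · haveI := h𝔭
        rcases (Ideal.IsPrime.mul_le h𝔭).mp hle with hg | hJ₀𝔭
        · exact Ideal.mul_mem_left _ _ ((Ideal.span_singleton_le_iff_mem _).mp hg)
        · exact absurd (eq_maximalIdeal_of_le_of_isFiniteLength_contentSupport hfin hJ₀𝔭) h𝔭m
    | succ i ih =>
      intro hdims
      obtain ⟨ih0, ih𝔭⟩ := ih fun j hj => hdims j (hj.trans (Nat.le_succ i))
      have hfi : Subring.inclusion (sequence_monotone hstep (Nat.zero_le (i + 1))) f =
          Subring.inclusion (hstep i).le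
            (Subring.inclusion (sequence_monotone hstep (Nat.zero_le i)) f) :=
        Subtype.ext rfl
      have hci : Subring.inclusion (sequence_monotone hstep (Nat.zero_le (i + 1))) (x₀ * g₀) =
          Subring.inclusion (hstep i).le
            (Subring.inclusion (sequence_monotone hstep (Nat.zero_le i)) (x₀ * g₀)) :=
        Subtype.ext rfl
      rw [hfi, hci]
      exact content_support_step_contentSupport O (R i) (R (i + 1)) (hstep i)
        (hdims i (Nat.le_succ i)) (sequence_dominates h0 hstep i).1 (hrich i) _ _ (hcm i) ih0 ih𝔭
  intro i hdims 𝔭 h𝔭 hz hle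
  obtain ⟨z, hzu, hz𝔭⟩ := hz
  refine (key i hdims).2 𝔭 h𝔭 (fun e => hz𝔭 ?_) hle
  rw [e]
  exact hzu

end Summit.ResolutionOfSingularities.ResolutionOfSingularities.Theorems.PfaffLine

end
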